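import Literature.Analysis.FluidPDE.ForwardDSSExistenceLocal
import Literature.Analysis.FluidPDE.ForwardDSSRepresentative
import Literature.Analysis.FluidPDE.SuitableWeakCongr
import HarnessLib

/-!
# Forward DSS solutions: the conclusion of Bradshaw–Tsai 2019, §4.3, up to representatives

Analysis/FluidPDE support file for the named fact `bradshawTsai2019_limit_4_3_local`
(`ForwardDSSExistenceLocal.lean`: the passage to the limit of Bradshaw–Tsai, *Discretely
self-similar solutions to the Navier–Stokes equations with data in `L²_loc` satisfying the local
energy inequality*, Analysis & PDE 12 (2019) = arXiv:1801.08060, **§4.3**, proof of Thm 1.2, p. 12,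
with the conclusion `IsBradshawTsai2019LocalSolution` on the unit cylinder `Q = (0, T) × B₁`).
One new definition (the predicate `IsBradshawTsai2019AELimit`), otherwise theorems.

`IsBradshawTsai2019LocalSolution c v₀ v π T` asks for functions on all of `ℝ × ℝ³` which are
`λ`-DSS **at every point** (`Fluid.IsDiscretelySelfSimilar`, `nsRescalePressure λ π = π`) and
attain the datum along **every** `t → 0⁺` — in print the tacit choice of a good representative
("`v` can be extended to a DSS solution on `ℝ³ × (0, ∞)` (which we still denote by `v`)"). What a
compactness argument delivers is a statement about the **Lebesgue class** of the limit pair on `Q`.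
This file records that class-level statement as the predicate

* `IsBradshawTsai2019AELimit c v₀ u p T`: `(u, p)` is a suitable weak solution on `Q` with the three
  bounds of Prop. 3.1, `u(t/λ², x/λ) = λ u(t, x)` and `p(t/λ², x/λ) = λ² p(t, x)` for **a.e.**
  `(t, x) ∈ Q` (with the accepted dilations `BradshawTsai2019.stDilate`), and the datum on compact
  `K ⊆ B₁` in the **essential** sense (`∀ ε > 0 ∃ δ > 0`: `∫_K |u(t) − v₀|² ≤ ε` for a.e.
  `t ∈ (0, δ)`),

and proves that it is **equivalent** to the representative-level conclusion:

* `IsBradshawTsai2019AELimit.exists_isBradshawTsai2019LocalSolution` — from an a.e. limit pair one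
  constructs `(U, P)` with `IsBradshawTsai2019LocalSolution c v₀ U P T`: extend `u`, `p` from `Q`
  along the scaling orbit (the accepted `BradshawTsai2019.dssExtend`, `ForwardDSSRepresentative`:
  exactly DSS, and `= u`, `= p` a.e. on `Q`, `dssExtend_ae_eq_of_ae`), then replace the velocity on
  a Lebesgue-null, scaling-closed set of time slices by the (DSS) datum `v₀` so that the datum is
  attained along *every* `t → 0⁺` (the construction of the accepted
  `BradshawTsai2019.exists_sliceDSS_modification`, `ForwardDSSCylinderLimitProofs.lean`, run here
  for the datum bounds rather than for the sliced DSS identity — so no slice-wise hypothesis at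
  every time is needed: the essential datum is first transported to the extension, whose slice is
  that of `u` for a.e. time, and the modification is performed last); suitability and the bounds
  only see Lebesgue classes (the accepted `IsSuitableWeakSolutionOn.congr_ae`);
* `IsBradshawTsai2019LocalSolution.isBradshawTsai2019AELimit` — the converse (pointwise identities
  hold a.e.; a limit along `𝓝[>] 0` is an essential limit);
* `bradshawTsai2019_limit_4_3_local_iff_ae` — hence `bradshawTsai2019_limit_4_3_local` holds iff
  its hypotheses yield an a.e. limit pair.

Relation to the tree: `ForwardDSSCylinderLimitProofs.lean` proves
`bradshawTsai2019_limit_4_3_local` (and Theorem 1.2) from the DSS-free compactness fact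
`bradshawTsai2019_cylinderLimit`, whose conclusion — strong `L²` convergence on the *whole* unit
cylinder, the datum along *every* `t` — is stronger than an a.e. limit pair. The equivalence here
records the weakest form in which the analytic debt of §4.3 may be paid: interior/Lebesgue-class
statements only (interior compactness suffices for the a.e. identities,
`ForwardDSSLimitGlue.lean`; the datum only in the essential sense).

## References

* Z. Bradshaw, T.-P. Tsai, Analysis & PDE 12 (2019) 1943–1962 = arXiv:1801.08060: §4.2, §4.3
  (proof of Thm 1.2, p. 12) [BradshawTsai2019].
* L. Caffarelli, R. Kohn, L. Nirenberg, Comm. Pure Appl. Math. 35 (1982), §2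
  [CaffarelliKohnNirenberg1982].
-/

noncomputable section

open MeasureTheory TopologicalSpace Set Function Filter Metric Module
open scoped InnerProductSpace RealInnerProductSpace ENNReal NNReal Topology

namespace Literature.Analysis.FluidPDE

/-- Local notation for physical space `ℝ³ = EuclideanSpace ℝ (Fin 3)`. -/
local notation "ℝ³" => EuclideanSpace ℝ (Fin 3)

/-! ## The conclusion of §4.3 up to representatives -/

/-- **The conclusion of Bradshaw–Tsai 2019, §4.3, up to the choice of representatives** — what the
passage to the limit (arXiv:1801.08060, p. 12) delivers about the *Lebesgue class* of the limit pair
`(u, p)` of the `λ`-DSS local Leray solutions `(v_k, π_k)` on the unit cylinder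
`Q = (0, T) × B₁ = timeCylinder unitBall 0 T`, for the scaling factor `c = λ` and the datum `v₀`:
`(u, p)` is a suitable weak solution (`ν = 1`, `f = 0`, CKN) on `Q` ("`v_k` converges to `v` [...]
in `L²(0,T;L²(B₁))` [...] `π_k` [...] converges weakly to [...] `π ∈ L^{3/2}(0,T;L^{3/2}(B₁))`
[...] The local energy inequality for `v` plainly follows"); the classes `u ∈ L^∞(0,T;L²(B₁))` (an
`∀ᵐ t` bound), `∇u ∈ L²(Q)` for a weak spatial gradient on `Q`, `p ∈ L^{3/2}(Q)` (the bounds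
(3.1)–(3.2) of Prop. 3.1 passed to the limit); `u(t/λ², x/λ) = λ u(t, x)` and
`p(t/λ², x/λ) = λ² p(t, x)` for **a.e.** `(t, x) ∈ Q` — the shrinking `(t, x) ↦ (t/λ², x/λ)` is the
accepted `BradshawTsai2019.stDilate c (-1)`, which maps `Q` into itself — (the limits of the
`λ`-DSS pairs `(v_k, π_k)`; §4.3: "`v_k` [...] satisfies (v.eq-core) for every `m ∈ ℤ` and
`φ ∈ 𝒟^m_{Q_κ}`. Thus, `v` can be extended to a DSS solution", §4.2); and the datum in the
**essential** sense: for every compact `K ⊆ B₁` and `ε > 0` there is `δ > 0` with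
`∫_K ‖u(t) − v₀‖² ≤ ε` for a.e. `t ∈ (0, δ)` ("For compact subsets `K` of `B₁`, we automatically
have `lim_{t→0⁺} ‖v − v₀‖_{L²(K)} = 0`", read for the Lebesgue class).
`IsBradshawTsai2019AELimit.exists_isBradshawTsai2019LocalSolution` chooses the representative
required by `IsBradshawTsai2019LocalSolution`; conversely every such representative is an a.e.
limit pair (`IsBradshawTsai2019LocalSolution.isBradshawTsai2019AELimit`), so that
`bradshawTsai2019_limit_4_3_local` may equivalently be discharged with this conclusion
(`bradshawTsai2019_limit_4_3_local_iff_ae`). [cite: BradshawTsai2019, §4.3 (proof of Thm 1.2)] -/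
def IsBradshawTsai2019AELimit (c : ℝ) (v₀ : ℝ³ → ℝ³) (u : ℝ → ℝ³ → ℝ³) (p : ℝ → ℝ³ → ℝ)
    (T : ℝ) : Prop :=
  IsSuitableWeakSolutionOn (timeCylinder unitBall 0 T) 1 0 u p ∧
  (∃ C₀ : ℝ≥0, ∀ᵐ t ∂(volume.restrict (Ioo 0 T)), ∫⁻ x in ball (0 : ℝ³) 1, ‖u t x‖ₑ ^ 2 ≤ C₀) ∧
  (∃ G₀ : ℝ → ℝ³ → ℝ³ →L[ℝ] ℝ³, HasWeakSpatialGradientOn (timeCylinder unitBall 0 T) u G₀ ∧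
    ∫⁻ z in Ioo 0 T ×ˢ ball (0 : ℝ³) 1, ENNReal.ofReal (frobeniusNormSq (G₀ z.1 z.2)) < ⊤) ∧
  ∫⁻ z in Ioo 0 T ×ˢ ball (0 : ℝ³) 1, ‖p z.1 z.2‖ₑ ^ (3 / 2 : ℝ) < ⊤ ∧
  (∀ᵐ z : ℝ × ℝ³ ∂volume, z ∈ Ioo 0 T ×ˢ ball (0 : ℝ³) 1 →
    uncurry u (BradshawTsai2019.stDilate c (-1) z) = c • uncurry u z) ∧
  (∀ᵐ z : ℝ × ℝ³ ∂volume, z ∈ Ioo 0 T ×ˢ ball (0 : ℝ³) 1 →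
    uncurry p (BradshawTsai2019.stDilate c (-1) z) = c ^ 2 * uncurry p z) ∧
  ∀ K : Set ℝ³, IsCompact K → K ⊆ ball 0 1 → ∀ ε : ℝ≥0∞, 0 < ε →
    ∃ δ : ℝ, 0 < δ ∧ ∀ᵐ t ∂(volume.restrict (Ioo 0 δ)), ∫⁻ x in K, ‖u t x - v₀ x‖ₑ ^ 2 ≤ ε

/-! ## Every representative is an a.e. limit pair -/

/-- **The representative-level conclusion implies the class-level one**: a pair with
`IsBradshawTsai2019LocalSolution c v₀ v π T` is an a.e. limit pair (the pointwise DSS identities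
hold in particular a.e. on the cylinder, in the shrink form by
`BradshawTsai2019.apply_stDilate_neg_one_of_isDiscretelySelfSimilar` /
`…_of_nsRescalePressure`; a limit along `𝓝[>] 0` is an essential limit). [cite: BradshawTsai2019, §4.3 (proof of Thm 1.2)] -/
theorem IsBradshawTsai2019LocalSolution.isBradshawTsai2019AELimit {c : ℝ} (hc : c ≠ 0)
    {v₀ : ℝ³ → ℝ³} {v : ℝ → ℝ³ → ℝ³} {π : ℝ → ℝ³ → ℝ} {T : ℝ}
    (h : IsBradshawTsai2019LocalSolution c v₀ v π T) : IsBradshawTsai2019AELimit c v₀ v π T := by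
  obtain ⟨hu, hp, hsuit, hen, hgrad, hpress, hdatum⟩ := h
  refine ⟨hsuit, hen, hgrad, hpress, Eventually.of_forall fun z _ => ?_,
    Eventually.of_forall fun z _ => ?_, fun K hK hKB ε hε => ?_⟩
  · exact BradshawTsai2019.apply_stDilate_neg_one_of_isDiscretelySelfSimilar hc hu z
  · exact BradshawTsai2019.apply_stDilate_neg_one_of_nsRescalePressure hc hp z
  · have hev := ENNReal.tendsto_nhds_zero.1 (hdatum K hK hKB) ε hε
    obtain ⟨δ, hδ, hδsub⟩ := mem_nhdsGT_iff_exists_Ioo_subset.1 hev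
    exact ⟨δ, hδ, (ae_restrict_iff' measurableSet_Ioo).2 (Eventually.of_forall fun t ht => hδsub ht)⟩

/-! ## From an a.e. limit pair to the representative of Theorem 1.2 -/

namespace IsBradshawTsai2019AELimit

variable {c : ℝ} {v₀ : ℝ³ → ℝ³} {u : ℝ → ℝ³ → ℝ³} {p : ℝ → ℝ³ → ℝ} {T : ℝ}

/-- If two fields agree a.e. on the unit cylinder then for a.e. time their slices agree a.e. on the
unit ball (a Lebesgue-null subset of `ℝ × ℝ³` has null slices for a.e. time). [folklore] -/
theorem ae_slice_eq_of_ae_eq {F : Type*} {g g' : ℝ → ℝ³ → F}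
    (h : ∀ᵐ z : ℝ × ℝ³ ∂volume, z ∈ Ioo 0 T ×ˢ ball (0 : ℝ³) 1 → uncurry g' z = uncurry g z) :
    ∀ᵐ t : ℝ ∂volume, ∀ᵐ x : ℝ³ ∂volume, (t, x) ∈ Ioo 0 T ×ˢ ball (0 : ℝ³) 1 → g' t x = g t x := by
  have h1 : ∀ᵐ z : ℝ × ℝ³ ∂(volume : Measure ℝ).prod (volume : Measure ℝ³),
      z ∈ Ioo 0 T ×ˢ ball (0 : ℝ³) 1 → uncurry g' z = uncurry g z := by
    rwa [← Measure.volume_eq_prod]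
  exact Measure.ae_ae_of_ae_prod
    (p := fun z : ℝ × ℝ³ => z ∈ Ioo 0 T ×ˢ ball (0 : ℝ³) 1 → uncurry g' z = uncurry g z) h1

/-- A field a.e. equal on the unit cylinder to one attaining the datum in the essential sense
attains it in the essential sense. [folklore] -/
theorem essDatum_congr_ae (hT : 0 < T) {u' : ℝ → ℝ³ → ℝ³}
    (hu' : ∀ᵐ z : ℝ × ℝ³ ∂volume, z ∈ Ioo 0 T ×ˢ ball (0 : ℝ³) 1 → uncurry u' z = uncurry u z)
    (hdat : ∀ K : Set ℝ³, IsCompact K → K ⊆ ball 0 1 → ∀ ε : ℝ≥0∞, 0 < ε →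
      ∃ δ : ℝ, 0 < δ ∧ ∀ᵐ t ∂(volume.restrict (Ioo 0 δ)), ∫⁻ x in K, ‖u t x - v₀ x‖ₑ ^ 2 ≤ ε)
    (K : Set ℝ³) (hK : IsCompact K) (hKB : K ⊆ ball 0 1) (ε : ℝ≥0∞) (hε : 0 < ε) :
    ∃ δ : ℝ, 0 < δ ∧ ∀ᵐ t ∂(volume.restrict (Ioo 0 δ)),
      ∫⁻ x in K, ‖u' t x - v₀ x‖ₑ ^ 2 ≤ ε := by
  obtain ⟨δ, hδ, hδ'⟩ := hdat K hK hKB ε hε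
  refine ⟨min δ T, lt_min hδ hT, ?_⟩
  have h1 := (ae_restrict_iff' (measurableSet_Ioo (a := (0 : ℝ)) (b := δ))).1 hδ'
  refine (ae_restrict_iff' measurableSet_Ioo).2 ?_
  filter_upwards [ae_slice_eq_of_ae_eq hu', h1] with t ht ht' htI
  have htδ : t ∈ Ioo 0 δ := ⟨htI.1, htI.2.trans_le (min_le_left _ _)⟩
  have htT : t ∈ Ioo 0 T := ⟨htI.1, htI.2.trans_le (min_le_right _ _)⟩
  refine le_of_eq_of_le (setLIntegral_congr_fun_ae hK.isClosed.measurableSet ?_) (ht' htδ)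
  filter_upwards [ht] with x hx hxK
  rw [hx ⟨htT, hKB hxK⟩]

/-- **The everywhere-DSS representative with the datum along every `t → 0⁺`** (Bradshaw–Tsai
2019, §4.3: "`v` can be extended to a DSS solution on `ℝ³ × (0,∞)` (which we still denote by
`v`) [...] For compact subsets `K` of `B₁`, we automatically have `lim_{t→0⁺} ‖v − v₀‖_{L²(K)} = 0`").
From an a.e. limit pair `(u, p)` on the unit cylinder `Q` one obtains `(U, P)` with
`IsBradshawTsai2019LocalSolution c v₀ U P T`: `P = dssExtend λ λ² Q p` and `U` is
`dssExtend λ λ Q u` with its time slices over a null, scaling-closed set of times `B` replaced by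
the datum `v₀` — `B` being the saturation `⋃ⱼ λ^{-2j} B₀` of the null set `B₀` of times at which the
essential datum bounds of the extension fail (the construction of the accepted
`BradshawTsai2019.exists_sliceDSS_modification`, run for the datum bounds instead of the sliced
DSS identity); `(U, P)` is exactly `λ`-DSS, equals `(u, p)` a.e. on the cylinder — whence
suitability and the bounds (`IsSuitableWeakSolutionOn.congr_ae`) — and attains `v₀` in `L²(K)`,
`K ⊆ B₁` compact, along every `t → 0⁺`. [cite: BradshawTsai2019, §4.3 (proof of Thm 1.2) with §4.2] -/
theorem exists_isBradshawTsai2019LocalSolution (h : IsBradshawTsai2019AELimit c v₀ u p T)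
    (hc : 1 < c) (hT : 0 < T) (hdss₀ : nsRescaleData c v₀ = v₀) :
    ∃ (U : ℝ → ℝ³ → ℝ³) (P : ℝ → ℝ³ → ℝ), IsBradshawTsai2019LocalSolution c v₀ U P T := by
  classical
  obtain ⟨hsuit, ⟨C₀, hen⟩, ⟨G₀, hG₀, hG₀fin⟩, hpress, hudss, hpdss, hdat⟩ := h
  have hc0 : 0 < c := zero_lt_one.trans hc
  have hQm : MeasurableSet (Ioo 0 T ×ˢ ball (0 : ℝ³) 1) := measurableSet_Ioo.prod measurableSet_ball
  have hW := BradshawTsai2019.stDilate_neg_one_mem_cylinder (E := ℝ³) hc.le T 1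
  have hex : ∀ z ∈ Ioo 0 T ×ˢ ball (0 : ℝ³) 1, ∃ j : ℤ, BradshawTsai2019.stDilate c j z ∈
      BradshawTsai2019.topLayer c (Ioo 0 T ×ˢ ball (0 : ℝ³) 1) := fun z hz =>
    BradshawTsai2019.exists_stDilate_mem_topLayer_cylinder hc hT one_pos hz.1.1
  -- Step 1: the exactly DSS extensions of `u` and `p` from the unit cylinder
  set U₀ : ℝ → ℝ³ → ℝ³ := fun t x =>
    BradshawTsai2019.dssExtend c c (Ioo 0 T ×ˢ ball (0 : ℝ³) 1) (uncurry u) (t, x) with hU₀def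
  set P : ℝ → ℝ³ → ℝ := fun t x =>
    BradshawTsai2019.dssExtend c (c ^ 2) (Ioo 0 T ×ˢ ball (0 : ℝ³) 1) (uncurry p) (t, x) with hPdef
  have hU₀dss : IsDiscretelySelfSimilar c U₀ :=
    BradshawTsai2019.isDiscretelySelfSimilar_dssExtend hc0.ne' hW (uncurry u)
  have hPdss : nsRescalePressure c P = P :=
    BradshawTsai2019.nsRescalePressure_dssExtend hc0.ne' hW (uncurry p)
  have hU₀ae : ∀ᵐ z : ℝ × ℝ³ ∂volume, z ∈ Ioo 0 T ×ˢ ball (0 : ℝ³) 1 →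
      uncurry U₀ z = uncurry u z :=
    BradshawTsai2019.dssExtend_ae_eq_of_ae hc0 hW hex hudss
  have hPae : ∀ᵐ z : ℝ × ℝ³ ∂volume, z ∈ Ioo 0 T ×ˢ ball (0 : ℝ³) 1 →
      uncurry P z = uncurry p z :=
    BradshawTsai2019.dssExtend_ae_eq_of_ae hc0 hW hex (by simpa only [smul_eq_mul] using hpdss)
  -- Step 2: the essential datum for `U₀`, and the bad set of times
  have hdat₀ := essDatum_congr_ae hT hU₀ae hdat
  set ρ : ℕ → ℝ := fun m => (m + 1) / (m + 2) with hρ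
  have hρ1 : ∀ m, ρ m < 1 := fun m => by
    rw [hρ]; dsimp only; rw [div_lt_one (by positivity)]; linarith
  have hKm : ∀ m, IsCompact (closedBall (0 : ℝ³) (ρ m)) := fun m => isCompact_closedBall _ _
  have hKmB : ∀ m, closedBall (0 : ℝ³) (ρ m) ⊆ ball 0 1 := fun m =>
    closedBall_subset_ball (hρ1 m)
  set ε : ℕ → ℝ≥0∞ := fun n => ((n : ℝ≥0∞) + 1)⁻¹ with hε
  have hεpos : ∀ n, 0 < ε n := fun n => ENNReal.inv_pos.2 (by simp)
  choose δ hδ hδ' using fun n m => hdat₀ (closedBall (0 : ℝ³) (ρ m)) (hKm m) (hKmB m) (ε n)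
    (hεpos n)
  set B₀ : Set ℝ := ⋃ n : ℕ, ⋃ m : ℕ, {t | t ∈ Ioo 0 (δ n m) ∧
    ¬ ∫⁻ x in closedBall (0 : ℝ³) (ρ m), ‖U₀ t x - v₀ x‖ₑ ^ 2 ≤ ε n} with hB₀
  have hB₀null : volume B₀ = 0 := by
    refine measure_iUnion_null fun n => measure_iUnion_null fun m => ?_
    rw [measure_eq_zero_iff_ae_notMem]
    filter_upwards [(ae_restrict_iff' measurableSet_Ioo).1 (hδ' n m)] with t ht
    rintro ⟨ht1, ht2⟩
    exact ht2 (ht ht1)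
  -- the scaling-closed null set of bad times (the construction of
  -- `BradshawTsai2019.exists_sliceDSS_modification`, here for the datum bounds)
  set B : Set ℝ := ⋃ j : ℤ, (fun t => (c ^ 2) ^ j * t) ⁻¹' B₀ with hB
  have hBnull : volume B = 0 := by
    refine measure_iUnion_null fun j => ?_
    rw [Real.volume_preimage_mul_left (zpow_ne_zero j (pow_ne_zero 2 hc0.ne')), hB₀null, mul_zero]
  have hBinv : ∀ t, t ∈ B ↔ c ^ 2 * t ∈ B := by
    intro t
    have hc2 : c ^ 2 ≠ 0 := pow_ne_zero 2 hc0.ne'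
    simp only [hB, mem_iUnion, mem_preimage]
    constructor
    · rintro ⟨j, hj⟩
      refine ⟨j - 1, ?_⟩
      rwa [← mul_assoc, ← zpow_add_one₀ hc2, sub_add_cancel]
    · rintro ⟨j, hj⟩
      refine ⟨j + 1, ?_⟩
      rwa [zpow_add_one₀ hc2, mul_assoc]
  have hB₀B : B₀ ⊆ B := fun t ht => mem_iUnion.2 ⟨0, by simpa using ht⟩
  -- Step 3: the surgery — replace the slices over `B` by the datum
  set U : ℝ → ℝ³ → ℝ³ := fun t x => if t ∈ B then v₀ x else U₀ t x with hUdef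
  have hU_of_mem : ∀ {t : ℝ}, t ∈ B → ∀ x, U t x = v₀ x := fun ht x => by
    simp [hUdef, ht]
  have hU_of_notMem : ∀ {t : ℝ}, t ∉ B → ∀ x, U t x = U₀ t x := fun ht x => by
    simp [hUdef, ht]
  have hUdss : IsDiscretelySelfSimilar c U := by
    funext t x
    rw [nsRescale_apply]
    by_cases ht : t ∈ B
    · rw [hU_of_mem ((hBinv t).1 ht), hU_of_mem ht]
      exact congrFun hdss₀ x
    · have ht' : c ^ 2 * t ∉ B := fun h => ht ((hBinv t).2 h)
      rw [hU_of_notMem ht', hU_of_notMem ht]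
      exact congrFun (congrFun hU₀dss t) x
  have hUslice : ∀ᵐ t : ℝ ∂volume, U t = U₀ t := by
    filter_upwards [measure_eq_zero_iff_ae_notMem.1 hBnull] with t ht
    exact funext fun x => hU_of_notMem ht x
  have hUU₀ : uncurry U =ᵐ[(volume : Measure (ℝ × ℝ³))] uncurry U₀ := by
    have h2 : ∀ᵐ z : ℝ × ℝ³ ∂volume, z.1 ∉ B := by
      have := (Measure.quasiMeasurePreserving_fst (μ := (volume : Measure ℝ))
        (ν := (volume : Measure ℝ³))).ae (measure_eq_zero_iff_ae_notMem.1 hBnull)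
      rwa [← Measure.volume_eq_prod] at this
    filter_upwards [h2] with z hz
    exact hU_of_notMem hz z.2
  have hUae : ∀ᵐ z : ℝ × ℝ³ ∂volume, z ∈ Ioo 0 T ×ˢ ball (0 : ℝ³) 1 →
      uncurry U z = uncurry u z := by
    filter_upwards [hUU₀, hU₀ae] with z hz hz' hzQ
    rw [hz, hz' hzQ]
  -- a.e. equalities on the cylinder, in the form consumed by `congr_ae`
  have hUae' : ∀ᵐ z ∂(volume.restrict
      ((timeCylinder unitBall 0 T : Opens (ℝ × ℝ³)) : Set (ℝ × ℝ³))),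
      uncurry u z = uncurry U z :=
    (ae_restrict_iff' hQm).2 (by filter_upwards [hUae] with z hz hzQ using (hz hzQ).symm)
  have hPae' : ∀ᵐ z ∂(volume.restrict
      ((timeCylinder unitBall 0 T : Opens (ℝ × ℝ³)) : Set (ℝ × ℝ³))),
      uncurry p z = uncurry P z :=
    (ae_restrict_iff' hQm).2 (by filter_upwards [hPae] with z hz hzQ using (hz hzQ).symm)
  refine ⟨U, P, hUdss, hPdss, hsuit.congr_ae hUae' hPae', ⟨C₀, ?_⟩,
    ⟨G₀, hG₀.congr_ae hUae', hG₀fin⟩, ?_, fun K hK hKB => ?_⟩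
  · -- the sliced energy bound
    have hen' := (ae_restrict_iff' (measurableSet_Ioo (a := (0 : ℝ)) (b := T))).1 hen
    refine (ae_restrict_iff' measurableSet_Ioo).2 ?_
    filter_upwards [ae_slice_eq_of_ae_eq hU₀ae, hen', hUslice] with t ht ht' hUt htI
    rw [hUt]
    refine le_of_eq_of_le (setLIntegral_congr_fun_ae measurableSet_ball ?_) (ht' htI)
    filter_upwards [ht] with x hx hxB
    rw [hx ⟨htI, hxB⟩]
  · -- the pressure class
    refine lt_of_eq_of_lt (setLIntegral_congr_fun_ae hQm ?_) hpress
    filter_upwards [hPae] with z hz hzQ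
    have e : P z.1 z.2 = p z.1 z.2 := hz hzQ
    rw [e]
  · -- the datum along every `t → 0⁺`
    -- `K` lies in one of the closed balls `B̄_{ρ m}`
    obtain ⟨m, hm⟩ : ∃ m : ℕ, K ⊆ closedBall (0 : ℝ³) (ρ m) := by
      obtain ⟨r', hr', hKr'⟩ := exists_lt_subset_ball hK.isClosed hKB
      obtain ⟨m, hm⟩ := exists_nat_gt (1 / (1 - r'))
      refine ⟨m, hKr'.trans (ball_subset_closedBall.trans (closedBall_subset_closedBall ?_))⟩
      have h1 : 0 < 1 - r' := by linarith
      rw [div_lt_iff₀ h1] at hm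
      rw [hρ]; dsimp only
      rw [le_div_iff₀ (by positivity)]
      nlinarith
    refine ENNReal.tendsto_nhds_zero.2 fun η hη => ?_
    obtain ⟨n, hn⟩ := ENNReal.exists_inv_nat_lt hη.ne'
    have hεn : ε n ≤ η := by
      refine le_trans (ENNReal.inv_le_inv.2 ?_) hn.le
      exact le_add_right le_rfl
    filter_upwards [Ioo_mem_nhdsGT (hδ n m)] with t ht
    by_cases htB : t ∈ B
    · have e : ∀ x, U t x = v₀ x := hU_of_mem htB
      simp [e]
    · have htB₀ : t ∉ B₀ := fun h' => htB (hB₀B h')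
      have hgood : ∫⁻ x in closedBall (0 : ℝ³) (ρ m), ‖U₀ t x - v₀ x‖ₑ ^ 2 ≤ ε n := by
        by_contra hcon
        exact htB₀ (mem_iUnion.2 ⟨n, mem_iUnion.2 ⟨m, ht, hcon⟩⟩)
      have e : ∀ x, U t x = U₀ t x := hU_of_notMem htB
      simp only [e]
      exact ((lintegral_mono_set hm).trans hgood).trans hεn

end IsBradshawTsai2019AELimit

/-! ## The equivalence for the named fact -/

/-- **`bradshawTsai2019_limit_4_3_local` up to representatives**: the named fact (the passage to
the limit of Bradshaw–Tsai 2019, §4.3, with conclusion `IsBradshawTsai2019LocalSolution`) holds if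
and only if its hypotheses yield an **a.e. limit pair** `IsBradshawTsai2019AELimit` — the
class-level statement a compactness argument delivers (suitability on the cylinder, the three
bounds, a.e. discrete self-similarity, the datum in the essential sense). The hypothesis block is
literally that of `bradshawTsai2019_limit_4_3_local`. [cite: BradshawTsai2019, §4.3 (proof of Thm 1.2)] -/
theorem bradshawTsai2019_limit_4_3_local_iff_ae :
    bradshawTsai2019_limit_4_3_local ↔
      ∀ {c : ℝ}, 1 < c → ∀ {v₀ : ℝ³ → ℝ³}, AEStronglyMeasurable v₀ volume →
        LocallyIntegrable (fun x => ‖v₀ x‖ ^ 2) volume → IsWeaklyDivFree v₀ →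
          nsRescaleData c v₀ = v₀ →
        ∀ {w₀ : ℕ → ℝ³ → ℝ³} {v : ℕ → ℝ → ℝ³ → ℝ³} {π : ℕ → ℝ → ℝ³ → ℝ} {T : ℝ} {C : ℝ≥0},
        (∀ k, FunctionSpaces.MemWeakLp (w₀ k) 3 volume) → (∀ k, IsWeaklyDivFree (w₀ k)) →
        (∀ k, nsRescaleData c (w₀ k) = w₀ k) →
        Tendsto (fun k => ∫⁻ x in ball (0 : ℝ³) 1, ‖w₀ k x - v₀ x‖ₑ ^ 2) atTop (𝓝 0) →
        (∀ k, IsLocalLeraySolution 1 (w₀ k) (v k) (π k)) →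
        (∀ k, IsDiscretelySelfSimilar c (v k)) →
        (∀ k, nsRescalePressure c (π k) = π k) →
        0 < T →
        (∀ k, ∀ᵐ t ∂(volume.restrict (Ioo 0 T)), ∫⁻ x in ball (0 : ℝ³) 1, ‖v k t x‖ₑ ^ 2 ≤ C) →
        (∀ k, ∃ G : ℝ → ℝ³ → ℝ³ →L[ℝ] ℝ³,
          HasWeakSpatialGradientOn (slab ℝ³ (Ioi 0) isOpen_Ioi) (v k) G ∧
          ∫⁻ z in Ioo 0 T ×ˢ ball (0 : ℝ³) 1,
            ENNReal.ofReal (frobeniusNormSq (G z.1 z.2)) ≤ C) →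
        (∀ k, ∫⁻ z in Ioo 0 T ×ˢ ball (0 : ℝ³) 1, ‖π k z.1 z.2‖ₑ ^ (3 / 2 : ℝ) ≤ C) →
        ∃ (u : ℝ → ℝ³ → ℝ³) (p : ℝ → ℝ³ → ℝ), IsBradshawTsai2019AELimit c v₀ u p T := by
  constructor
  · intro h c hc v₀ hm₀ hL2 hdiv hdss₀ w₀ v π T C hw hwdiv hwdss hconv hLL hvdss hπdss hT hE hG hP
    obtain ⟨u, p, hup⟩ := h hc hm₀ hL2 hdiv hdss₀ hw hwdiv hwdss hconv hLL hvdss hπdss hT hE hG hP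
    exact ⟨u, p, hup.isBradshawTsai2019AELimit (zero_lt_one.trans hc).ne'⟩
  · intro h c hc v₀ hm₀ hL2 hdiv hdss₀ w₀ v π T C hw hwdiv hwdss hconv hLL hvdss hπdss hT hE hG hP
    obtain ⟨u, p, hup⟩ := h hc hm₀ hL2 hdiv hdss₀ hw hwdiv hwdss hconv hLL hvdss hπdss hT hE hG hP
    exact hup.exists_isBradshawTsai2019LocalSolution hc hT hdss₀

end Literature.Analysis.FluidPDE

end
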